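import Mathlib
import Literature.NumberTheory.LFunctions.Zhang2022.Section15CU055Residue
import Literature.NumberTheory.LFunctions.Zhang2022.Section15CU055LData
import Literature.NumberTheory.LFunctions.Zhang2022.SkeletonAlpha1
import HarnessLib

/-!
# The residue at `s = 0` in §15 p. 87 of Zhang (2022): `Res = L′(1,χ)²U(1) + O(α𝓛³(1+|L′(1,χ)|)²·S)`

Topic `Literature/NumberTheory/LFunctions/Zhang2022` (Landau–Siegel audit tree; verdict-neutral).
Y. Zhang, *Discrete mean estimates and the Landau–Siegel zero*, arXiv:2211.02515v1 (2022)
[Zhang2022LandauSiegel] — **an unrefereed manuscript under adjudication**; nothing here asserts or denies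
its Theorems 1–2. Step "`Σ_{n<T} χ(n)τ₂(n)ϖ₁ⱼ(n)/n = L′(1,χ)²𝒰₁ⱼ(1) + O(α₁)`" (§15 p. 87, tex L4359–L4361),
RESIDUE PART in the reading of record `Typed.Section15C.Step15_u055RelS` (RT-07′): for all large `D`,
under (A), `j ∈ {1,2,3}`, any `U` analytic on `Re s ≥ 9/10` with `‖U(s)‖ ≤ S` on `|s−1| ≤ 1/𝓛`, the
residue at the triple pole `s = 0` of `ζ(1+s)²L(1+s−βⱼ,χ)²U(1+s)Tˢω₁(s)/s` (`ω₁ = ω₁(𝓛³⁰,·)`, `T` of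
(2.1)) — in the `dslope` format of the tree's residue theorem — is `L′(1,χ)²U(1)` up to
`C·α𝓛³·(1+‖L′(1,χ)‖)²·S` (`norm_residue_sub_main_le`). Assembly of the generic size lemma
`U055.norm_residue_triple_sub_le` (`Section15CU055Residue`) at `r = 1/𝓛`, `Y = T`, `Λ = 𝓛³⁰` with the
`L`-data `U055.sqShift_bounds` (`Section15CU055LData`). Theorems only; reading-independent apart from the
name of the error scale. WHAT THIS IS NOT: the contour shift or the unsmoothing (other files), nor anything
about Theorems 1–2 / Landau–Siegel zeros.

## References
* Y. Zhang, arXiv:2211.02515v1 (2022), §15 p. 87, tex L4354–L4361. [cite: Zhang2022LandauSiegel, §15 p.87]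
-/

noncomputable section

open Complex Real Set Filter Topology Metric

namespace Literature.NumberTheory.LFunctions.Zhang2022.U055

open Literature.NumberTheory.LFunctions.Zhang2022.Skeleton GaussWeight

/-- `M ≤ 𝓛` once `D ≥ ⌈e^M⌉`. [cite: Zhang2022LandauSiegel, §2 (2.1)] -/
private theorem le_ell_of_ceil_exp_le₈ {M : ℝ} {D : ℕ} (hD : ⌈Real.exp M⌉₊ ≤ D) : M ≤ ell D := by
  have h : Real.exp M ≤ D := le_trans (Nat.le_ceil _) (by exact_mod_cast hD)
  exact (Real.le_log_iff_exp_le (lt_of_lt_of_le (Real.exp_pos _) h)).mpr h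

/-- Real bookkeeping: the size lemma's right side at `r = 1/L`, `log Y ≤ L²`, with the `L`-data bounds,
is `≤ C_M(11+5K)·αL³(1+ℓ)²S` (`αL² ≤ 1`, `αL⁴ ≤ 1`, `α ≤ 1`, `L ≥ 1`). [folklore] -/
private theorem residue_bookkeeping {μ₂ μ₁ μ₀ S K lY α L ℓ CM : ℝ} (hS : 0 ≤ S) (hK : 0 ≤ K)
    (hlY : 0 ≤ lY) (hlY2 : lY ≤ L ^ 2) (hα : 0 ≤ α) (hα1 : α ≤ 1) (hαL2 : α * L ^ 2 ≤ 1)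
    (hαL4 : α * L ^ 4 ≤ 1) (hL : 1 ≤ L) (hℓ : 0 ≤ ℓ) (hCM : 0 ≤ CM)
    (h₂ : μ₂ ≤ CM * α * L ^ 3 * (1 + ℓ)) (h₁ : μ₁ ≤ CM * α * (1 + ℓ) ^ 2)
    (h₀ : μ₀ ≤ CM * α ^ 2 * (1 + ℓ) ^ 2) (hμ₁ : 0 ≤ μ₁) (hμ₀ : 0 ≤ μ₀) :
    μ₂ * S + μ₁ * (2 * S / (1 / L)) + μ₀ * (4 * S / (1 / L) ^ 2) +
        (K + lY) * (μ₁ * S + μ₀ * (2 * S / (1 / L))) + (K + K * lY + lY ^ 2 / 2) * (μ₀ * S) ≤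
      CM * (11 + 5 * K) * (α * L ^ 3) * ((1 + ℓ) ^ 2 * S) := by
  have hL0 : 0 < L := by linarith
  have e1 : 2 * S / (1 / L) = 2 * S * L := by field_simp
  have e2 : 4 * S / (1 / L) ^ 2 = 4 * S * L ^ 2 := by field_simp
  rw [e1, e2]
  have hL3 : (1 : ℝ) ≤ L ^ 3 := one_le_pow₀ hL
  have hLL3 : L ≤ L ^ 3 := by
    calc L = L ^ 1 := (pow_one L).symm
      _ ≤ L ^ 3 := pow_le_pow_right₀ hL (by norm_num)
  have hL2L3 : L ^ 2 ≤ L ^ 3 := pow_le_pow_right₀ hL (by norm_num)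
  have h1ℓ : (1 : ℝ) ≤ 1 + ℓ := by linarith
  have h1ℓ2 : 1 + ℓ ≤ (1 + ℓ) ^ 2 := by
    calc 1 + ℓ = (1 + ℓ) ^ 1 := (pow_one _).symm
      _ ≤ (1 + ℓ) ^ 2 := pow_le_pow_right₀ h1ℓ (by norm_num)
  have hαL : α * L ≤ 1 := by
    calc α * L ≤ α * L ^ 2 := by
          apply mul_le_mul_of_nonneg_left _ hα
          calc L = L ^ 1 := (pow_one L).symm
            _ ≤ L ^ 2 := pow_le_pow_right₀ hL (by norm_num)
      _ ≤ 1 := hαL2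
  set P : ℝ := α * (1 + ℓ) ^ 2 * S with hP
  have hP0 : 0 ≤ P := by positivity
  set Q : ℝ := CM * P * L ^ 3 with hQ
  have hQ0 : 0 ≤ Q := by positivity
  have hPQ : CM * P ≤ Q := by
    rw [hQ]; exact le_mul_of_one_le_right (by positivity) hL3
  -- the pieces
  have i₁ : μ₁ * S ≤ CM * P := by
    calc μ₁ * S ≤ CM * α * (1 + ℓ) ^ 2 * S := mul_le_mul_of_nonneg_right h₁ hS
      _ = CM * P := by rw [hP]; ring
  have i₀ : μ₀ * S ≤ CM * P * α := by
    calc μ₀ * S ≤ CM * α ^ 2 * (1 + ℓ) ^ 2 * S := mul_le_mul_of_nonneg_right h₀ hS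
      _ = CM * P * α := by rw [hP]; ring
  have t1 : μ₂ * S ≤ Q := by
    calc μ₂ * S ≤ CM * α * L ^ 3 * (1 + ℓ) * S := mul_le_mul_of_nonneg_right h₂ hS
      _ ≤ CM * α * L ^ 3 * (1 + ℓ) ^ 2 * S := by
          apply mul_le_mul_of_nonneg_right _ hS
          exact mul_le_mul_of_nonneg_left h1ℓ2 (by positivity)
      _ = Q := by rw [hQ, hP]; ring
  have t2 : μ₁ * (2 * S * L) ≤ 2 * Q := by
    calc μ₁ * (2 * S * L) = 2 * (μ₁ * S) * L := by ring
      _ ≤ 2 * (CM * P) * L := by gcongr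
      _ ≤ 2 * (CM * P) * L ^ 3 := by gcongr
      _ = 2 * Q := by rw [hQ]; ring
  have t3 : μ₀ * (4 * S * L ^ 2) ≤ 4 * Q := by
    calc μ₀ * (4 * S * L ^ 2) = 4 * (μ₀ * S) * L ^ 2 := by ring
      _ ≤ 4 * (CM * P * α) * L ^ 2 := by gcongr
      _ = 4 * (CM * P) * (α * L ^ 2) := by ring
      _ ≤ 4 * (CM * P) * 1 := by gcongr
      _ ≤ 4 * Q := by linarith
  have t4 : (K + lY) * (μ₁ * S + μ₀ * (2 * S * L)) ≤ (3 * K + 3) * Q := by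
    have j₀ : μ₀ * (2 * S * L) ≤ 2 * (CM * P) := by
      calc μ₀ * (2 * S * L) = 2 * (μ₀ * S) * L := by ring
        _ ≤ 2 * (CM * P * α) * L := by gcongr
        _ = 2 * (CM * P) * (α * L) := by ring
        _ ≤ 2 * (CM * P) * 1 := by gcongr
        _ = 2 * (CM * P) := mul_one _
    have j₁ : μ₁ * S + μ₀ * (2 * S * L) ≤ 3 * (CM * P) := by linarith
    have j₂ : K + lY ≤ (K + 1) * L ^ 3 := by
      have : K ≤ K * L ^ 3 := le_mul_of_one_le_right hK hL3
      have : lY ≤ L ^ 3 := hlY2.trans hL2L3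
      linarith
    calc (K + lY) * (μ₁ * S + μ₀ * (2 * S * L)) ≤ ((K + 1) * L ^ 3) * (3 * (CM * P)) :=
          mul_le_mul j₂ j₁ (by positivity) (by positivity)
      _ = (3 * K + 3) * Q := by rw [hQ]; ring
  have t5 : (K + K * lY + lY ^ 2 / 2) * (μ₀ * S) ≤ (2 * K + 1) * Q := by
    have j₁ : (K + K * lY + lY ^ 2 / 2) * α ≤ 2 * K + 1 / 2 := by
      have a1 : K * α ≤ K := mul_le_of_le_one_right hK hα1
      have a2 : K * lY * α ≤ K := by
        calc K * lY * α ≤ K * L ^ 2 * α := by gcongr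
          _ = K * (α * L ^ 2) := by ring
          _ ≤ K * 1 := by gcongr
          _ = K := mul_one K
      have a3 : lY ^ 2 / 2 * α ≤ 1 / 2 := by
        have : lY ^ 2 ≤ L ^ 4 := by
          calc lY ^ 2 ≤ (L ^ 2) ^ 2 := pow_le_pow_left₀ hlY hlY2 2
            _ = L ^ 4 := by ring
        calc lY ^ 2 / 2 * α ≤ L ^ 4 / 2 * α := by gcongr
          _ = (α * L ^ 4) / 2 := by ring
          _ ≤ 1 / 2 := by linarith
      have e : (K + K * lY + lY ^ 2 / 2) * α = K * α + K * lY * α + lY ^ 2 / 2 * α := by ring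
      linarith
    calc (K + K * lY + lY ^ 2 / 2) * (μ₀ * S) ≤ (K + K * lY + lY ^ 2 / 2) * (CM * P * α) :=
          mul_le_mul_of_nonneg_left i₀ (by positivity)
      _ = ((K + K * lY + lY ^ 2 / 2) * α) * (CM * P) := by ring
      _ ≤ (2 * K + 1 / 2) * (CM * P) := mul_le_mul_of_nonneg_right j₁ (by positivity)
      _ ≤ (2 * K + 1 / 2) * Q := mul_le_mul_of_nonneg_left hPQ (by positivity)
      _ ≤ (2 * K + 1) * Q := mul_le_mul_of_nonneg_right (by linarith) hQ0
  have e : CM * (11 + 5 * K) * (α * L ^ 3) * ((1 + ℓ) ^ 2 * S) = (11 + 5 * K) * Q := by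
    rw [hQ, hP]; ring
  rw [e]
  have : Q + 2 * Q + 4 * Q + (3 * K + 3) * Q + (2 * K + 1) * Q = (11 + 5 * K) * Q := by ring
  linarith

/-- **The residue at `s = 0` is `L′(1,χ)²U(1) + O(α𝓛³(1+|L′(1,χ)|)²S)`** (§15 p. 87; RESIDUE PART of
`Typed.Section15C.Step15_u055RelS`): for all large `D`, under (A), for `j ∈ {1,2,3}`, every `U` analytic
on `{Re s ≥ 9/10}` with `‖U(s)‖ ≤ S` for `‖s − 1‖ ≤ 1/𝓛`,
`‖((swap dslope 0)^[2] φ) 0 − L′(1,χ)²·U(1)‖ ≤ C·α𝓛³·(1+‖L′(1,χ)‖)²·S`, where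
`φ(z) = ζ₁(1+z)²·(L(1+z−βⱼ,χ)²U(1+z))·Tᶻω₁(z)` is the numerator of the triple pole of
`ζ(1+z)²L(1+z−βⱼ,χ)²U(1+z)·Tᶻω₁(z)/z` at `0` and `((swap dslope 0)^[2] φ) 0` its residue (`= ½φ″(0)`,
`U055.residue_triple_eq`). [cite: Zhang2022LandauSiegel, §15 p.87] -/
theorem norm_residue_sub_main_le (c' : ℝ) :
    ∃ C : ℝ, 0 ≤ C ∧ ForAllLarge fun D _ χ => AssumptionA D χ → ∀ j ∈ ({1, 2, 3} : Finset ℕ),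
      ∀ U : ℂ → ℂ, AnalyticOnNhd ℂ U {s : ℂ | 9 / 10 ≤ s.re} → ∀ S : ℝ,
        (∀ s : ℂ, ‖s - 1‖ ≤ 1 / ell D → ‖U s‖ ≤ S) →
        ‖(Function.swap dslope (0 : ℂ))^[2]
            (fun z => riemannZeta₁ (1 + z) ^ 2 *
              (χ.LFunction (1 + z - betaJ c' D j) ^ 2 * U (1 + z)) *
              (((bigT D : ℝ) : ℂ) ^ z * omega1 (ell D ^ 30) z)) 0 -
          deriv χ.LFunction 1 ^ 2 * U 1‖ ≤
          C * (alpha D * ell D ^ 3) * ((1 + ‖deriv χ.LFunction 1‖) ^ 2 * S) := by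
  obtain ⟨K, hK0, hK⟩ := norm_residue_triple_sub_le
  set CM : ℝ := 2000 * Real.exp (9 / 2) with hCM
  have hCM0 : 0 ≤ CM := by positivity
  refine ⟨CM * (11 + 5 * K), by positivity, ?_⟩
  have hT : ForAllLarge fun D _ _ => (10 : ℝ) ≤ ell D :=
    ForAllLarge.of_le ⌈Real.exp 10⌉₊ fun D _ _ hD _ _ => le_ell_of_ceil_exp_le₈ hD
  obtain ⟨D₀, h⟩ := (sqShift_bounds c').and hT
  refine ⟨D₀, fun D _ χ hD hq hp hA j hj U hU S hS => ?_⟩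
  obtain ⟨hMB, hℓ10⟩ := h D χ hD hq hp
  obtain ⟨b₀, b₁, b₂⟩ := hMB hA j hj
  have hℓ1 : 1 ≤ ell D := by linarith
  have hℓ0 : 0 < ell D := by linarith
  have hD2 : 2 ≤ D := by
    by_contra hlt
    have : D ≤ 1 := by omega
    have : (D : ℝ) ≤ 1 := by exact_mod_cast this
    have : ell D ≤ 0 := by rw [ell]; exact Real.log_nonpos (Nat.cast_nonneg _) this
    linarith
  have hχ1 := Lemma31.ne_one_of_isPrimitive χ hD2 hp
  set β := betaJ c' D j with hβ
  -- parameters of the size lemma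
  have hΛ : (1 : ℝ) ≤ ell D ^ 30 := one_le_pow₀ hℓ1
  have hY : (1 : ℝ) ≤ bigT D := by
    rw [bigT]; exact Real.one_le_exp (Real.rpow_nonneg hℓ0.le _)
  have hr : (0 : ℝ) < 1 / ell D := by positivity
  -- `V(z) = U(1+z)` on `ball 0 (1/𝓛)`
  have hre : ∀ z ∈ ball (0 : ℂ) (1 / ell D), 9 / 10 ≤ (1 + z).re := by
    intro z hz
    rw [mem_ball_zero_iff] at hz
    have h1 : |z.re| ≤ ‖z‖ := Complex.abs_re_le_norm z
    have h2 : 1 / ell D ≤ 1 / 10 := one_div_le_one_div_of_le (by norm_num) hℓ10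
    simp only [Complex.add_re, Complex.one_re]
    have := neg_abs_le z.re
    linarith
  have hVd : DifferentiableOn ℂ (fun z => U (1 + z)) (ball (0 : ℂ) (1 / ell D)) := by
    intro z hz
    have ha : AnalyticAt ℂ U (1 + z) := hU _ (hre z hz)
    exact (ha.differentiableAt.comp z ((differentiableAt_const _).add differentiableAt_id)).differentiableWithinAt
  have hVS : ∀ z ∈ ball (0 : ℂ) (1 / ell D), ‖U (1 + z)‖ ≤ S := by
    intro z hz
    refine hS _ ?_
    rw [mem_ball_zero_iff] at hz
    rw [show (1 : ℂ) + z - 1 = z by ring]; exact hz.le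
  obtain ⟨hMd, -, -, -⟩ := sqShift_data χ hχ1 β
  have hMd' : DifferentiableOn ℂ (fun z : ℂ => χ.LFunction (1 + z - β) ^ 2) (ball (0 : ℂ) (1 / ell D)) :=
    hMd.differentiableOn
  -- `dslope` form → `½φ″(0)`
  have hball : ball (0 : ℂ) (1 / ell D) ∈ 𝓝 (0 : ℂ) := ball_mem_nhds 0 hr
  have hg : DifferentiableOn ℂ (fun z : ℂ => χ.LFunction (1 + z - β) ^ 2 * U (1 + z))
      (ball (0 : ℂ) (1 / ell D)) := hMd'.mul hVd
  have hTpos : 0 < bigT D := lt_of_lt_of_le zero_lt_one hY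
  obtain ⟨V', hV', hφd, -⟩ := pole_datum_triple hball hg (ell D ^ 30) hTpos
  rw [residue_triple_eq hV' hφd]
  -- the size lemma
  have hsize := hK (ell D ^ 30) (bigT D) (1 / ell D) S (fun z : ℂ => χ.LFunction (1 + z - β) ^ 2)
    (fun z => U (1 + z)) (deriv χ.LFunction 1 ^ 2) hΛ hY hr hMd' hVd hVS
  beta_reduce at hsize
  simp only [add_zero] at hsize
  refine hsize.trans ?_
  -- bookkeeping
  have hlogT : Real.log (bigT D) = ell D ^ (1.1 : ℝ) := log_bigT D
  have hlY2 : Real.log (bigT D) ≤ ell D ^ 2 := by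
    rw [hlogT]
    calc ell D ^ (1.1 : ℝ) ≤ ell D ^ (2 : ℝ) := Real.rpow_le_rpow_of_exponent_le hℓ1 (by norm_num)
      _ = ell D ^ 2 := by norm_cast
  have hlY0 : 0 ≤ Real.log (bigT D) := Real.log_nonneg hY
  have hα : alpha D = π / ell D ^ 9 := by rw [alpha, bigP, Real.log_exp]
  have hαpos : 0 < alpha D := by rw [hα]; positivity
  have hπ4 : π ≤ 4 := by linarith [Real.pi_lt_d2]
  have hℓ9 : ell D ≤ ell D ^ 9 := by
    calc ell D = ell D ^ 1 := (pow_one _).symm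
      _ ≤ ell D ^ 9 := pow_le_pow_right₀ hℓ1 (by norm_num)
  have hα1 : alpha D ≤ 1 := by
    rw [hα, div_le_one (by positivity)]; linarith
  have hαL2 : alpha D * ell D ^ 2 ≤ 1 := by
    rw [hα, div_mul_eq_mul_div, div_le_one (by positivity)]
    calc π * ell D ^ 2 ≤ 4 * ell D ^ 2 := by gcongr
      _ ≤ ell D * ell D ^ 2 := by gcongr; linarith
      _ = ell D ^ 3 := by ring
      _ ≤ ell D ^ 9 := pow_le_pow_right₀ hℓ1 (by norm_num)
  have hαL4 : alpha D * ell D ^ 4 ≤ 1 := by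
    rw [hα, div_mul_eq_mul_div, div_le_one (by positivity)]
    calc π * ell D ^ 4 ≤ 4 * ell D ^ 4 := by gcongr
      _ ≤ ell D * ell D ^ 4 := by gcongr; linarith
      _ = ell D ^ 5 := by ring
      _ ≤ ell D ^ 9 := pow_le_pow_right₀ hℓ1 (by norm_num)
  exact residue_bookkeeping (le_trans (norm_nonneg _) (hS 1 (by simp; positivity))) hK0 hlY0 hlY2
    hαpos.le hα1 hαL2 hαL4 hℓ1 (norm_nonneg _) hCM0 b₂ b₁ b₀ (norm_nonneg _) (norm_nonneg _)

end Literature.NumberTheory.LFunctions.Zhang2022.U055
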